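import Literature.Computability.AlgebraicComplexity.QuasiPolynomialFormulasProofs
import Literature.Barriers.ValiantsHypothesis.MonotoneGapPermanentLower
import Summits.ValiantsHypothesis.ValiantsHypothesis.Theses.DivisionGap
import Summits.ValiantsHypothesis.ValiantsHypothesis.Theorems.DivisionGapShadowCofactorSplitFormula

/-!
# `ShadowCofactorSplit` (item stmt-ValiantsHypothesis-15047) — ShadowBirkhoff wired into H1

Route `route-ValiantsHypothesis-DivisionGap`.  The item is the glue
`ShadowCofactorSplit : ShadowBirkhoff → PerCofactorDegreeReduction → PerMultiplesHard`,
proved here as `shadowCofactorSplit_proof` (file 2 of 2; the pencil-count calculus and the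
formula bound `sh_eval_le` are in `DivisionGapShadowCofactorSplitFormula.lean`).

* `ncard_extremePoints_le_of_multiple` — **HY21 Thm. 42 for the tree's formula model, Birkhoff
  instance**: if `h' ≠ 0` then every shadow `L(DS_n)` has at most `4(3·E₊(per_n·h') + 1)`
  vertices, `E₊ = formulaComplexity` over `ℝ≥0`: each vertex is uniquely supported by one of four
  separating coordinate pencils (`extremePoints_subset_um4`), `L(mon per_n) = L(vert DS_n)`
  (`support_perPoly`), a Minkowski summand has at most as many uniquely supported points
  (`sh_le_sh_mul`, using `mon(per·h') = mon per + mon h'` over `ℝ≥0`), and the formula bound.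
* `exists_exponent` — the exponent bookkeeping `18E² + 4 ≤ (log₂ n + c₂)^{c₂}`.
* `shadowCofactorSplit_proof` — the item: if `PerMultiplesHard` fails with exponent `c` then for
  the `n ≥ n₀` it supplies, degree reduction plus the balancing theorem
  `formulaComplexity_le_two_pow` (BCS 1997 (21.35)/(21.36), any commutative semiring, hence
  monotone over `ℝ≥0`) give a monotone formula of size `2^{18E²}` for some `per_n · h'`, `h' ≠ 0`,
  whence EVERY shadow of `DS_n` has `≤ 2^{(log₂ n + c₂)^{c₂}}` vertices — contradicting
  `ShadowBirkhoff` at `c₂`.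

## References

* P. Hrubeš, A. Yehudayoff, *Shadows of Newton polytopes*, CCC 2021, LIPIcs 200:9, Thm. 1,
  Lemma 12, Thm. 42 [HrubesYehudayoff2021].
* P. Bürgisser, M. Clausen, M. A. Shokrollahi, *Algebraic Complexity Theory*, Springer 1997,
  Thm. (21.35) (Brent), Thm. (21.36) (Hyafil, Valiant–Skyum–Berkowitz–Rackoff)
  [BurgisserClausenShokrollahi1997].
-/

noncomputable section

-- `Summit.ValiantsHypothesis.ValiantsHypothesis.…` is the tree's single-conjunct layout (Sub = Summit).
set_option linter.dupNamespace false

namespace Summit.ValiantsHypothesis.ValiantsHypothesis.Theorems.DivisionGap.ShadowCofactorSplit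

open scoped Pointwise NNReal
open MvPolynomial
open Literature.Computability.AlgebraicComplexity
open Literature.Barriers.ValiantsHypothesis.JerrumSnir
open Summit.ValiantsHypothesis.DivisionGap.ShadowDegreeSplit

local notation3 (prettyPrint := false) "UM[" c ", " d ", " X "]" =>
  {p | p ∈ X ∧ ∃ t : ℝ, ∀ q ∈ X, q ≠ p → c q + t * d q < c p + t * d p}

local notation3 (prettyPrint := false) "PT[" φ ", " f "]" =>
  (⇑φ) '' ((MvPolynomial.support f : Finset _) : Set _)

local notation3 (prettyPrint := false) "SH[" φ ", " c ", " d ", " f "]" =>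
  Set.ncard {p | p ∈ PT[φ, f] ∧ ∃ t : ℝ, ∀ q ∈ PT[φ, f], q ≠ p → c q + t * d q < c p + t * d p}

/-! ## Part 3. The Birkhoff shadow under a cheap multiple, exponent bookkeeping, and the item -/

section Main

open Summit.ValiantsHypothesis.ValiantsHypothesis.Theses.DivisionGap

/-- **HY21 Thm. 42 for the tree's formula model, Birkhoff instance.** If `h' ≠ 0`, then for every
linear `L : ℝ^{n×n} → ℝ²` the shadow polygon `L(DS_n)` has at most `4 · (3·E₊(per_n·h') + 1)`
vertices, `E₊ = formulaComplexity` over `ℝ≥0` (monotone fan-in-two formula size): every vertex is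
uniquely supported by one of four separating pencils (`extremePoints_subset_um4`), along which
`|UM(L(mon per_n))| ≤ |UM(L(mon (per_n·h')))| ≤ 3·E₊ + 1` (`sh_le_sh_mul`, `sh_eval_le`).
[cite: HrubesYehudayoff2021, Thm. 42 (= Thm. 1 with Lemma 12)] -/
theorem ncard_extremePoints_le_of_multiple {n : ℕ} (L : (Fin n × Fin n → ℝ) →ₗ[ℝ] (Fin 2 → ℝ))
    (h' : MvPolynomial (Fin n × Fin n) ℝ≥0) (hh' : h' ≠ 0) :
    (Set.extremePoints ℝ (convexHull ℝ (L '' permMatrixPoints n))).ncard ≤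
      4 * (3 * formulaComplexity (perPoly (Fin n) ℝ≥0 * h') + 1) := by
  classical
  -- the additive map: exponent vector ↦ `L` of the corresponding real point
  let φ : (Fin n × Fin n →₀ ℕ) →+ (Fin 2 → ℝ) :=
    { toFun := fun m => L (fun ij => ((m ij : ℕ) : ℝ))
      map_zero' := by
        show L (fun ij => (((0 : Fin n × Fin n →₀ ℕ) ij : ℕ) : ℝ)) = 0
        have h0 : (fun ij : Fin n × Fin n => (((0 : Fin n × Fin n →₀ ℕ) ij : ℕ) : ℝ)) = 0 := by
          funext ij
          simp
        rw [h0, map_zero]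
      map_add' := by
        intro a b
        show L (fun ij => (((a + b) ij : ℕ) : ℝ)) =
          L (fun ij => ((a ij : ℕ) : ℝ)) + L (fun ij => ((b ij : ℕ) : ℝ))
        rw [← map_add]
        congr 1
        funext ij
        simp [Nat.cast_add] }
  have hφ : ∀ m : Fin n × Fin n →₀ ℕ, φ m = L (fun ij => ((m ij : ℕ) : ℝ)) := fun _ => rfl
  -- its values on permutation monomials are the projected permutation matrices
  have hφM : ∀ ρ : Equiv.Perm (Fin n),
      φ (permMonomial ρ) = L (fun ij => if ρ ij.2 = ij.1 then 1 else 0) := by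
    intro ρ
    rw [hφ]
    congr 1
    funext ij
    obtain ⟨r, s⟩ := ij
    rw [permMonomial_apply]
    split_ifs <;> simp
  have hPT : PT[φ, perPoly (Fin n) ℝ≥0] = L '' permMatrixPoints n := by
    rw [support_perPoly ℝ≥0, Finset.coe_image, Finset.coe_univ, Set.image_univ, ← Set.range_comp]
    ext p
    simp only [Set.mem_range, permMatrixPoints, Set.mem_image, Set.mem_setOf_eq,
      Function.comp_apply]
    constructor
    · rintro ⟨ρ, rfl⟩
      exact ⟨_, ⟨ρ, rfl⟩, (hφM ρ).symm⟩
    · rintro ⟨_, ⟨ρ, rfl⟩, rfl⟩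
      exact ⟨ρ, hφM ρ⟩
  -- an optimal monotone formula for `per_n · h'`
  obtain ⟨P, hF, hfan, hcomp, hsize⟩ :=
    ArithCircuit.exists_computes_size_eq_formulaComplexity (perPoly (Fin n) ℝ≥0 * h')
  have hfin : (L '' permMatrixPoints n).Finite := by
    rw [← hPT]
    exact finite_pts φ _
  refine ncard_extremePoints_le_of_separating_pencils _ hfin _ fun c d hsep => ?_
  rw [← hPT]
  calc SH[φ, c, d, perPoly (Fin n) ℝ≥0]
      ≤ SH[φ, c, d, perPoly (Fin n) ℝ≥0 * h'] := sh_le_sh_mul φ c d _ _ hh' hsep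
    _ = SH[φ, c, d, P.eval] := by rw [show P.eval = perPoly (Fin n) ℝ≥0 * h' from hcomp]
    _ ≤ 3 * P.size + 1 := sh_eval_le φ c d P hF hfan
    _ = 3 * formulaComplexity (perPoly (Fin n) ℝ≥0 * h') + 1 := by rw [hsize]

/-! ### Exponent bookkeeping -/

/-- For `2 ≤ y`: if `a ≤ y^p`, `b ≤ y^q` and `p + q + 1 ≤ r` then `a + b ≤ y^r`. [folklore] -/
theorem add_le_pow_of_le {y a b p q r : ℕ} (hy : 2 ≤ y) (ha : a ≤ y ^ p) (hb : b ≤ y ^ q)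
    (hr : p + q + 1 ≤ r) : a + b ≤ y ^ r := by
  have h1 : y ^ p ≤ y ^ (p + q) := Nat.pow_le_pow_right (by omega) (by omega)
  have h2 : y ^ q ≤ y ^ (p + q) := Nat.pow_le_pow_right (by omega) (by omega)
  calc a + b ≤ y ^ (p + q) + y ^ (p + q) := add_le_add (ha.trans h1) (hb.trans h2)
    _ = 2 * y ^ (p + q) := by ring
    _ ≤ y * y ^ (p + q) := Nat.mul_le_mul_right _ hy
    _ = y ^ (p + q + 1) := by rw [pow_succ]; ring
    _ ≤ y ^ r := Nat.pow_le_pow_right (by omega) hr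

/-- For `1 ≤ y`: if `a ≤ y^p`, `b ≤ y^q` and `p + q ≤ r` then `a · b ≤ y^r`. [folklore] -/
theorem mul_le_pow_of_le {y a b p q r : ℕ} (hy : 1 ≤ y) (ha : a ≤ y ^ p) (hb : b ≤ y ^ q)
    (hr : p + q ≤ r) : a * b ≤ y ^ r :=
  calc a * b ≤ y ^ p * y ^ q := Nat.mul_le_mul ha hb
    _ = y ^ (p + q) := (pow_add y p q).symm
    _ ≤ y ^ r := Nat.pow_le_pow_right hy hr

/-- For `1 ≤ y`: if `a ≤ y^p` and `p · m ≤ r` then `a^m ≤ y^r`. [folklore] -/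
theorem pow_le_pow_of_le {y a p r : ℕ} (hy : 1 ≤ y) (ha : a ≤ y ^ p) (m : ℕ) (hr : p * m ≤ r) :
    a ^ m ≤ y ^ r :=
  calc a ^ m ≤ (y ^ p) ^ m := Nat.pow_le_pow_left ha m
    _ = y ^ (p * m) := (pow_mul y p m).symm
    _ ≤ y ^ r := Nat.pow_le_pow_right hy hr

/-- **Exponent bookkeeping** of the glue: for every `c`, `k` there is `c₂` with
`18·E(ℓ)² + 4 ≤ (ℓ + c₂)^{c₂}` for all `ℓ`, where `E(ℓ) = (ℓ + (ℓ + c)^c + k)^k + 2ℓ + 3`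
(everything is a power of `y = ℓ + c + k + 2 ≥ 2`). [folklore] -/
theorem exists_exponent (c k : ℕ) : ∃ c₂ : ℕ, ∀ ℓ : ℕ,
    18 * ((ℓ + (ℓ + c) ^ c + k) ^ k + 2 * ℓ + 3) ^ 2 + 4 ≤ (ℓ + c₂) ^ c₂ := by
  refine ⟨2 * ((3 * c + 7) * k) + 20 + (c + k + 2), fun ℓ => ?_⟩
  set K := (3 * c + 7) * k with hK
  set M := c + k + 2 with hM
  set y := ℓ + M with hy
  have hy2 : 2 ≤ y := by omega
  have hy1 : 1 ≤ y := by omega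
  have hℓ : ℓ ≤ y ^ 1 := by rw [pow_one]; omega
  have hc : c ≤ y ^ 1 := by rw [pow_one]; omega
  have hk : k ≤ y ^ 1 := by rw [pow_one]; omega
  have h1 : ℓ + c ≤ y ^ 3 := add_le_pow_of_le hy2 hℓ hc (by omega)
  have h2 : (ℓ + c) ^ c ≤ y ^ (3 * c) := pow_le_pow_of_le hy1 h1 c (by omega)
  have h3 : ℓ + (ℓ + c) ^ c ≤ y ^ (3 * c + 5) := add_le_pow_of_le hy2 hℓ h2 (by omega)
  have h4 : ℓ + (ℓ + c) ^ c + k ≤ y ^ (3 * c + 7) := add_le_pow_of_le hy2 h3 hk (by omega)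
  have h5 : (ℓ + (ℓ + c) ^ c + k) ^ k ≤ y ^ K := pow_le_pow_of_le hy1 h4 k (by omega)
  have h6 : 2 * ℓ ≤ y ^ 2 := by
    rw [pow_two]
    exact Nat.mul_le_mul hy2 (by omega)
  have h7 : 3 ≤ y ^ 2 := by
    rw [pow_two]
    nlinarith
  have h8 : (ℓ + (ℓ + c) ^ c + k) ^ k + 2 * ℓ ≤ y ^ (K + 3) := add_le_pow_of_le hy2 h5 h6 (by omega)
  have h9 : (ℓ + (ℓ + c) ^ c + k) ^ k + 2 * ℓ + 3 ≤ y ^ (K + 6) :=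
    add_le_pow_of_le hy2 h8 h7 (by omega)
  have h10 : ((ℓ + (ℓ + c) ^ c + k) ^ k + 2 * ℓ + 3) ^ 2 ≤ y ^ (2 * K + 12) :=
    pow_le_pow_of_le hy1 h9 2 (by omega)
  have h18 : 18 ≤ y ^ 5 := le_trans (by norm_num : 18 ≤ 2 ^ 5) (Nat.pow_le_pow_left hy2 5)
  have h11 : 18 * ((ℓ + (ℓ + c) ^ c + k) ^ k + 2 * ℓ + 3) ^ 2 ≤ y ^ (2 * K + 17) :=
    mul_le_pow_of_le hy1 h18 h10 (by omega)
  have h4' : 4 ≤ y ^ 2 := by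
    rw [pow_two]
    exact Nat.mul_le_mul hy2 hy2
  have h12 : 18 * ((ℓ + (ℓ + c) ^ c + k) ^ k + 2 * ℓ + 3) ^ 2 + 4 ≤ y ^ (2 * K + 20) :=
    add_le_pow_of_le hy2 h11 h4' (by omega)
  calc 18 * ((ℓ + (ℓ + c) ^ c + k) ^ k + 2 * ℓ + 3) ^ 2 + 4 ≤ y ^ (2 * K + 20) := h12
    _ ≤ (ℓ + (2 * K + 20 + M)) ^ (2 * K + 20) := Nat.pow_le_pow_left (by omega) _
    _ ≤ (ℓ + (2 * K + 20 + M)) ^ (2 * K + 20 + M) := Nat.pow_le_pow_right (by omega) (by omega)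

/-! ### The item -/

/-- **Item `stmt-ValiantsHypothesis-15047` (`ShadowCofactorSplit`), proved**:
`ShadowBirkhoff → PerCofactorDegreeReduction → PerMultiplesHard`.

Suppose `PerMultiplesHard` fails: for some `c` and arbitrarily large `n` there is `h ≠ 0` with
`s = L₊(per_n · h) ≤ 2^((log₂ n + c)^c)`.  Degree reduction (exponent `k`) trades `h` for
`h' ≠ 0` with `deg h' ≤ 2^{E₁}` and `L₊(per_n · h') ≤ 2^{E₁}`,
`E₁ = (log₂ n + log₂ s + k)^k ≤ E₂ = (log₂ n + (log₂ n + c)^c + k)^k`.  With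
`E = E₂ + 2 log₂ n + 3` one has `deg(per_n · h') ≤ n + 2^{E₂} < 2^E`, `n² ≤ 2^E`,
`L₊ ≤ 2^E`, so the tree's balancing theorem `formulaComplexity_le_two_pow` (Hyafil /
Valiant–Skyum–Berkowitz–Rackoff with Brent, over the commutative semiring `ℝ≥0`, hence monotone)
gives a monotone formula for `per_n · h'` of size `≤ 2^{18E²}`.  By the formula shadow bound
(`ncard_extremePoints_le_of_multiple`, HrubesYehudayoff2021 Thm. 42) EVERY shadow `L(DS_n)` then has
at most `4(3·2^{18E²} + 1) ≤ 2^{18E² + 4} ≤ 2^((log₂ n + c₂)^{c₂})` vertices (`exists_exponent`),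
contradicting `ShadowBirkhoff` at exponent `c₂` for the `n ≥ n₀(c₂)` supplied by the failure of
`PerMultiplesHard`. [cite: HrubesYehudayoff2021, Thm. 42; BurgisserClausenShokrollahi1997, Thm. (21.35)/(21.36)] -/
theorem shadowCofactorSplit_proof :
    Summit.ValiantsHypothesis.ValiantsHypothesis.Theses.DivisionGap.ShadowCofactorSplit := by
  unfold ShadowCofactorSplit ShadowBirkhoff PerCofactorDegreeReduction PerMultiplesHard
  intro hSB hDR
  by_contra hPMH
  push Not at hPMH
  obtain ⟨c, hc⟩ := hPMH
  obtain ⟨k, hk⟩ := hDR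
  obtain ⟨c₂, hc₂⟩ := exists_exponent c k
  obtain ⟨n₀, hn₀⟩ := hSB c₂
  obtain ⟨n, hn, h, hh, hs⟩ := hc n₀
  obtain ⟨L, hL⟩ := hn₀ n hn
  obtain ⟨h', hh', hdeg, hcomp⟩ := hk n h hh
  -- abbreviations
  set s := complexity (perPoly (Fin n) ℝ≥0 * h) with hs_def
  set ℓ := Nat.log 2 n with hℓ
  set A := (ℓ + c) ^ c with hA
  have hlog : Nat.log 2 s ≤ A :=
    calc Nat.log 2 s ≤ Nat.log 2 (2 ^ A) := Nat.log_mono_right hs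
      _ = A := Nat.log_pow Nat.one_lt_two A
  set E₁ := (ℓ + Nat.log 2 s + k) ^ k with hE₁
  set E₂ := (ℓ + A + k) ^ k with hE₂
  have hE₁₂ : E₁ ≤ E₂ := Nat.pow_le_pow_left (by omega) k
  set E := E₂ + 2 * ℓ + 3 with hE
  -- the hypotheses of the balancing theorem
  have h2E : 2 ^ E = 2 ^ E₂ * 2 ^ (ℓ + 1) * 2 ^ (ℓ + 1) * 2 := by
    rw [hE, show E₂ + 2 * ℓ + 3 = E₂ + (ℓ + 1) + (ℓ + 1) + 1 by omega, pow_add, pow_add, pow_add,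
      pow_one]
  have hnlt : n < 2 ^ (ℓ + 1) := Nat.lt_pow_succ_log_self Nat.one_lt_two n
  have ha1 : 1 ≤ 2 ^ E₂ := Nat.one_le_two_pow
  have hb1 : 1 ≤ 2 ^ (ℓ + 1) := Nat.one_le_two_pow
  have hd : n + 2 ^ E₂ < 2 ^ E := by
    rw [h2E]
    have h1 : n + 2 ^ E₂ < 2 ^ (ℓ + 1) + 2 ^ E₂ := by omega
    have h2 : 2 ^ (ℓ + 1) ≤ 2 ^ E₂ * 2 ^ (ℓ + 1) * 2 ^ (ℓ + 1) :=
      calc 2 ^ (ℓ + 1) = 1 * 2 ^ (ℓ + 1) * 1 := by ring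
        _ ≤ 2 ^ E₂ * 2 ^ (ℓ + 1) * 2 ^ (ℓ + 1) :=
          Nat.mul_le_mul (Nat.mul_le_mul_right _ ha1) hb1
    have h3 : 2 ^ E₂ ≤ 2 ^ E₂ * 2 ^ (ℓ + 1) * 2 ^ (ℓ + 1) :=
      calc 2 ^ E₂ = 2 ^ E₂ * 1 * 1 := by ring
        _ ≤ 2 ^ E₂ * 2 ^ (ℓ + 1) * 2 ^ (ℓ + 1) :=
          Nat.mul_le_mul (Nat.mul_le_mul_left _ hb1) hb1
    omega
  have hcard : Fintype.card (Fin n × Fin n) ≤ 2 ^ E := by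
    rw [Fintype.card_prod, Fintype.card_fin, h2E]
    calc n * n ≤ 2 ^ (ℓ + 1) * 2 ^ (ℓ + 1) := Nat.mul_le_mul hnlt.le hnlt.le
      _ = 1 * 2 ^ (ℓ + 1) * 2 ^ (ℓ + 1) * 1 := by ring
      _ ≤ 2 ^ E₂ * 2 ^ (ℓ + 1) * 2 ^ (ℓ + 1) * 2 :=
          Nat.mul_le_mul (Nat.mul_le_mul_right _ (Nat.mul_le_mul_right _ ha1)) (by norm_num)
  have hper : (perPoly (Fin n) ℝ≥0).totalDegree ≤ n := by
    simpa using (perPoly_isHomogeneous (n := Fin n) (k := ℝ≥0)).totalDegree_le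
  have hdeg' : (perPoly (Fin n) ℝ≥0 * h').totalDegree ≤ n + 2 ^ E₂ :=
    calc (perPoly (Fin n) ℝ≥0 * h').totalDegree
        ≤ (perPoly (Fin n) ℝ≥0).totalDegree + h'.totalDegree := totalDegree_mul _ _
      _ ≤ n + 2 ^ E₁ := add_le_add hper hdeg
      _ ≤ n + 2 ^ E₂ := Nat.add_le_add_left (Nat.pow_le_pow_right Nat.two_pos hE₁₂) n
  have hL' : complexity (perPoly (Fin n) ℝ≥0 * h') ≤ 2 ^ E :=
    hcomp.trans ((Nat.pow_le_pow_right Nat.two_pos hE₁₂).trans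
      (Nat.pow_le_pow_right Nat.two_pos (by omega)))
  have hE1 : 1 ≤ E := by omega
  have hfc := formulaComplexity_le_two_pow hdeg' hd hcard hL' hE1
  -- the vertex bound for every shadow, in particular the one supplied by `ShadowBirkhoff`
  have hV := ncard_extremePoints_le_of_multiple L h' hh'
  have hexp : 18 * E ^ 2 + 4 ≤ (ℓ + c₂) ^ c₂ := by
    have := hc₂ ℓ
    rw [hE, hE₂, hA]
    exact this
  have hfinal : (Set.extremePoints ℝ (convexHull ℝ (L '' permMatrixPoints n))).ncard ≤
      2 ^ ((ℓ + c₂) ^ c₂) :=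
    calc (Set.extremePoints ℝ (convexHull ℝ (L '' permMatrixPoints n))).ncard
        ≤ 4 * (3 * formulaComplexity (perPoly (Fin n) ℝ≥0 * h') + 1) := hV
      _ ≤ 4 * (3 * 2 ^ (18 * E ^ 2) + 1) :=
          Nat.mul_le_mul_left 4 (Nat.add_le_add_right (Nat.mul_le_mul_left 3 hfc) 1)
      _ ≤ 2 ^ (18 * E ^ 2 + 4) := by
          rw [pow_add]
          have h16 : (2 : ℕ) ^ 4 = 16 := by norm_num
          rw [h16]
          have := Nat.one_le_two_pow (n := 18 * E ^ 2)
          omega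
      _ ≤ 2 ^ ((ℓ + c₂) ^ c₂) := Nat.pow_le_pow_right Nat.two_pos hexp
  exact absurd hL (not_lt.2 hfinal)

end Main

end Summit.ValiantsHypothesis.ValiantsHypothesis.Theorems.DivisionGap.ShadowCofactorSplit

end
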